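import Summits.AtomisticToContinuum.Crystallization.Theorems.ExcessDecayLiouvillePhononStabilityDefs
import Summits.AtomisticToContinuum.Crystallization.Theorems.ExcessDecayLiouvillePhononStabilityLabels

/-!
# Near-certificate layer 0: the generator frame of the hcp two-lattice

Support file for crux `PhononStability` (line `contragredient-window-collapse`): the generators `gen`
(`u, v, c`) and dual generators `dgen` of the period lattice, covariant / contravariant coordinates, the
pulled-back metric entries `Ĝᵢⱼ = ⟪A genᵢ, A genⱼ⟫` and `Ĥᵢⱼ = ⟪B dgenᵢ, B dgenⱼ⟫`, the rational contravariant
class vectors `ζ̂⁰_c = n + s·ι`, coordinates of everything, the two basis expansions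
`x = Σ ⟪dgenᵢ, x⟫ genᵢ = Σ ⟪genᵢ, x⟫ dgenᵢ`, and the consequences `⟪dgenᵢ, ζ_c(δ)⟫ = ζ̂⁰ᵢ + s⟪dgenᵢ, δ⟫`,
`‖Aζ_c(δ)‖² = ζ̂ᵀĜζ̂`, `⟪dgenᵢ, dgenⱼ⟫ = (M₀⁻¹)ᵢⱼ`. Pure linear algebra in `ℝ³`. [folklore]
-/

noncomputable section

open scoped BigOperators Classical InnerProductSpace
open Filter Set Function
open Summit.AtomisticToContinuum.Crystallization.Theorems.PhononStabilityNegative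
open Literature.MathematicalPhysics.StatisticalMechanics

namespace Summit.AtomisticToContinuum.Crystallization.Theorems.PhononStabilityCWC.Cert

local notation "E3" => EuclideanSpace ℝ (Fin 3)

/-! ## The frame -/

/-- The three generators as a function of the index. -/
def gen (i : Fin 3) : E3 := ![genU, genV, genC] i
/-- Covariant coordinates of a vector. -/
def covOf (x : E3) : Fin 3 → ℝ := fun i => inner ℝ (gen i) x

/-- dual generators -/
def dgen (i : Fin 3) : E3 :=
  ![(4 / 3 : ℝ) • genU - (2 / 3 : ℝ) • genV, -(2 / 3 : ℝ) • genU + (4 / 3 : ℝ) • genV, (3 / 8 : ℝ) • genC] i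
/-- the reference inner shift in generator coordinates -/
def iota : Fin 3 → ℚ := ![1 / 3, 1 / 3, 1 / 2]
/-- contravariant coordinates of a vector -/
def contraOf (x : E3) : Fin 3 → ℝ := fun i => inner ℝ (dgen i) x
/-- `Ĝᵢⱼ = ⟪A genᵢ, A genⱼ⟫` -/
def ghat (A : E3 →L[ℝ] E3) (i j : Fin 3) : ℝ := inner ℝ (A (gen i)) (A (gen j))
/-- `Ĥᵢⱼ = ⟪B dgenᵢ, B dgenⱼ⟫` -/
def hhat (B : E3 →L[ℝ] E3) (i j : Fin 3) : ℝ := inner ℝ (B (dgen i)) (B (dgen j))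
/-- the δ-independent contravariant class vector `ζ̂⁰_c = n + s ι` (rational) -/
def zhat0 (c : BondClass) (i : Fin 3) : ℚ := (c.2.2 i : ℚ) + (subSignQ c.2.1 - subSignQ c.1) * iota i
  where
  /-- rational sublattice sign -/
  subSignQ (m : Fin 2) : ℚ := if m = 1 then 1 else 0
/-- the sublattice sign difference `s = σ(m') − σ(m)` as a rational -/
def sdiff (c : BondClass) : ℚ := zhat0.subSignQ c.2.1 - zhat0.subSignQ c.1
/-- contravariant class vector `ζ̂_c(δ̂) = ζ̂⁰ + s δ̂` -/
def zhat (c : BondClass) (d : Fin 3 → ℝ) (i : Fin 3) : ℝ := (zhat0 c i : ℝ) + (sdiff c : ℝ) * d i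

/-- `Ĝ` is symmetric. [folklore] -/
theorem ghat_symm (A : E3 →L[ℝ] E3) (i j : Fin 3) : ghat A i j = ghat A j i := real_inner_comm _ _

/-- inverse Gram matrix of the generators -/
def M0inv : Fin 3 → Fin 3 → ℚ := ![![4 / 3, -2 / 3, 0], ![-2 / 3, 4 / 3, 0], ![0, 0, 3 / 8]]

/-- `Ĥ` is symmetric. [folklore] -/
theorem hhat_symm (B : E3 →L[ℝ] E3) (i j : Fin 3) : hhat B i j = hhat B j i := real_inner_comm _ _

/-! ## Coordinates -/

/-- the inner product of `ℝ³` in coordinates. [folklore] -/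
theorem inner_fin3 (x y : E3) : inner ℝ x y = x 0 * y 0 + x 1 * y 1 + x 2 * y 2 := by
  simp only [PiLp.inner_apply, RCLike.inner_apply, conj_trivial, Fin.sum_univ_three]
  ring

/-- coordinates of the generators `u = (1,0,0)`, `v = (1/2, √3/2, 0)`, `c = (0, 0, 2√(2/3))`. [folklore] -/
theorem gen_apply :
    (gen 0 0 = 1 ∧ gen 0 1 = 0 ∧ gen 0 2 = 0) ∧ (gen 1 0 = 1 / 2 ∧ gen 1 1 = √3 / 2 ∧ gen 1 2 = 0) ∧
      (gen 2 0 = 0 ∧ gen 2 1 = 0 ∧ gen 2 2 = 2 * √(2 / 3)) := by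
  refine ⟨⟨?_, ?_, ?_⟩, ⟨?_, ?_, ?_⟩, ⟨?_, ?_, ?_⟩⟩ <;>
    simp [gen, genU, genV, genC, triangularVec₁, triangularVec₂, layerNormal]

/-- coordinates of the dual generators `(1, −√3/3, 0)`, `(0, 2√3/3, 0)`, `(0, 0, (3/4)√(2/3))`. [folklore] -/
theorem dgen_apply :
    (dgen 0 0 = 1 ∧ dgen 0 1 = -(√3 / 3) ∧ dgen 0 2 = 0) ∧ (dgen 1 0 = 0 ∧ dgen 1 1 = 2 * √3 / 3 ∧ dgen 1 2 = 0) ∧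
      (dgen 2 0 = 0 ∧ dgen 2 1 = 0 ∧ dgen 2 2 = 3 / 4 * √(2 / 3)) := by
  refine ⟨⟨?_, ?_, ?_⟩, ⟨?_, ?_, ?_⟩, ⟨?_, ?_, ?_⟩⟩ <;>
    simp [dgen, genU, genV, genC, triangularVec₁, triangularVec₂, layerNormal] <;> ring

/-- `⟪dgenᵢ, x⟫` in coordinates. [folklore] -/
theorem contraOf_apply (x : E3) :
    contraOf x 0 = x 0 - √3 / 3 * x 1 ∧ contraOf x 1 = 2 * √3 / 3 * x 1 ∧ contraOf x 2 = 3 / 4 * √(2 / 3) * x 2 := by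
  obtain ⟨⟨a0, a1, a2⟩, ⟨b0, b1, b2⟩, ⟨c0, c1, c2⟩⟩ := dgen_apply
  simp only [contraOf, inner_fin3, a0, a1, a2, b0, b1, b2, c0, c1, c2]
  refine ⟨by ring, by ring, by ring⟩

/-- `⟪genᵢ, x⟫` in coordinates. [folklore] -/
theorem covOf_apply (x : E3) :
    covOf x 0 = x 0 ∧ covOf x 1 = 1 / 2 * x 0 + √3 / 2 * x 1 ∧ covOf x 2 = 2 * √(2 / 3) * x 2 := by
  obtain ⟨⟨a0, a1, a2⟩, ⟨b0, b1, b2⟩, ⟨c0, c1, c2⟩⟩ := gen_apply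
  simp only [covOf, inner_fin3, a0, a1, a2, b0, b1, b2, c0, c1, c2]
  refine ⟨by ring, by ring, by ring⟩

/-- **contravariant expansion** `x = Σᵢ ⟪dgenᵢ, x⟫ genᵢ`. [folklore] -/
theorem expand_contra (x : E3) : x = ∑ i, contraOf x i • gen i := by
  obtain ⟨⟨a0, a1, a2⟩, ⟨b0, b1, b2⟩, ⟨c0, c1, c2⟩⟩ := gen_apply
  obtain ⟨d0, d1, d2⟩ := contraOf_apply x
  have h3 : (√3 : ℝ) ^ 2 = 3 := Real.sq_sqrt (by norm_num)
  have h23 : (√(2 / 3) : ℝ) ^ 2 = 2 / 3 := Real.sq_sqrt (by norm_num)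
  ext i
  rw [Fin.sum_univ_three, PiLp.add_apply, PiLp.add_apply, PiLp.smul_apply, PiLp.smul_apply, PiLp.smul_apply,
    smul_eq_mul, smul_eq_mul, smul_eq_mul, d0, d1, d2]
  fin_cases i
  · simp only [Fin.zero_eta, a0, b0, c0]; ring
  · simp only [Fin.mk_one, a1, b1, c1]; linear_combination (-(1 / 3) * x 1) * h3
  · simp only [Fin.reduceFinMk, a2, b2, c2]; linear_combination (-(3 / 2) * x 2) * h23

/-- **covariant expansion** `x = Σᵢ ⟪genᵢ, x⟫ dgenᵢ`. [folklore] -/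
theorem expand_cov (x : E3) : x = ∑ i, covOf x i • dgen i := by
  obtain ⟨⟨a0, a1, a2⟩, ⟨b0, b1, b2⟩, ⟨c0, c1, c2⟩⟩ := dgen_apply
  obtain ⟨d0, d1, d2⟩ := covOf_apply x
  have h3 : (√3 : ℝ) ^ 2 = 3 := Real.sq_sqrt (by norm_num)
  have h23 : (√(2 / 3) : ℝ) ^ 2 = 2 / 3 := Real.sq_sqrt (by norm_num)
  ext i
  rw [Fin.sum_univ_three, PiLp.add_apply, PiLp.add_apply, PiLp.smul_apply, PiLp.smul_apply, PiLp.smul_apply,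
    smul_eq_mul, smul_eq_mul, smul_eq_mul, d0, d1, d2]
  fin_cases i
  · simp only [Fin.zero_eta, a0, b0, c0]; ring
  · simp only [Fin.mk_one, a1, b1, c1]; linear_combination (-(1 / 3) * x 1) * h3
  · simp only [Fin.reduceFinMk, a2, b2, c2]; linear_combination (-(3 / 2) * x 2) * h23

/-- `⟪dgenᵢ, latVec n⟫ = nᵢ`. [folklore] -/
theorem contraOf_latVec (n : Fin 3 → ℤ) (i : Fin 3) : contraOf (latVec n) i = n i := by
  obtain ⟨l0, l1, l2⟩ := LabelsStub.latVec_apply n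
  obtain ⟨d0, d1, d2⟩ := contraOf_apply (latVec n)
  have h3 : (√3 : ℝ) ^ 2 = 3 := Real.sq_sqrt (by norm_num)
  have h23 : (√(2 / 3) : ℝ) ^ 2 = 2 / 3 := Real.sq_sqrt (by norm_num)
  fin_cases i
  · simp only [Fin.zero_eta, d0, l0, l1]; linear_combination (-(1 / 6) * (n 1 : ℝ)) * h3
  · simp only [Fin.mk_one, d1, l1]; linear_combination (1 / 3 * (n 1 : ℝ)) * h3
  · simp only [Fin.reduceFinMk, d2, l2]; linear_combination ((n 2 : ℝ) * (3 / 2)) * h23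

/-- the entries of `ι`. [folklore] -/
theorem iota_val : iota 0 = 1 / 3 ∧ iota 1 = 1 / 3 ∧ iota 2 = 1 / 2 := ⟨rfl, rfl, rfl⟩

/-- `⟪dgenᵢ, innerRef⟫ = ιᵢ = (1/3, 1/3, 1/2)`. [folklore] -/
theorem contraOf_innerRef (i : Fin 3) : contraOf innerRef i = (iota i : ℝ) := by
  obtain ⟨r0, r1, r2⟩ := LabelsStub.innerRef_apply
  obtain ⟨d0, d1, d2⟩ := contraOf_apply innerRef
  obtain ⟨i0, i1, i2⟩ := iota_val
  have h3 : (√3 : ℝ) ^ 2 = 3 := Real.sq_sqrt (by norm_num)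
  have h23 : (√(2 / 3) : ℝ) ^ 2 = 2 / 3 := Real.sq_sqrt (by norm_num)
  fin_cases i
  · simp only [Fin.zero_eta, d0, r0, r1, i0]; push_cast; linear_combination (-(1 / 18 : ℝ)) * h3
  · simp only [Fin.mk_one, d1, r1, i1]; push_cast; linear_combination (1 / 9 : ℝ) * h3
  · simp only [Fin.reduceFinMk, d2, r2, i2]; push_cast; linear_combination (3 / 4 : ℝ) * h23

/-- `contraOf` is additive. [folklore] -/
theorem contraOf_add (x y : E3) (i : Fin 3) : contraOf (x + y) i = contraOf x i + contraOf y i := by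
  simp [contraOf, inner_add_right]

/-- `contraOf` is homogeneous. [folklore] -/
theorem contraOf_smul (a : ℝ) (x : E3) (i : Fin 3) : contraOf (a • x) i = a * contraOf x i := by
  simp [contraOf, inner_smul_right]

/-- the rational sublattice sign is the real one. [folklore] -/
theorem subSignQ_cast (m : Fin 2) : ((zhat0.subSignQ m : ℚ) : ℝ) = subSign m := by
  unfold zhat0.subSignQ subSign
  split_ifs <;> simp

/-- **(ii) contravariant class vectors:** `⟪dgenᵢ, ζ_c(δ)⟫ = ζ̂⁰ᵢ + s·⟪dgenᵢ, δ⟫`. [folklore] -/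
theorem contraOf_bondVec (δ : E3) (c : BondClass) : contraOf (bondVec δ c) = zhat c (contraOf δ) := by
  obtain ⟨m, m', n⟩ := c
  funext i
  have hb : bondVec δ (m, m', n) = latVec n + (subSign m' - subSign m) • (innerRef + δ) := by
    have h : ∀ ℓ : Label, refPos δ ℓ = latVec ℓ.2 + subSign ℓ.1 • (innerRef + δ) := by
      intro ℓ; unfold refPos subSign; split_ifs <;> simp
    have h0 : latVec 0 = 0 := by simp [latVec]
    simp only [bondVec, h, h0, zero_add, sub_smul]
    abel
  rw [hb, contraOf_add, contraOf_smul, contraOf_add, contraOf_latVec, contraOf_innerRef]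
  simp only [zhat, zhat0, sdiff, Rat.cast_add, Rat.cast_mul, Rat.cast_sub, Rat.cast_intCast, subSignQ_cast]
  ring

/-- **(i) bond lengths through `Ĝ`:** `‖Aζ_c(δ)‖² = ζ̂ᵀ Ĝ ζ̂`. [folklore] -/
theorem norm_sq_bondVec_chart (A : E3 →L[ℝ] E3) (δ : E3) (c : BondClass) :
    ‖A (bondVec δ c)‖ ^ 2 = ∑ i, ∑ j, zhat c (contraOf δ) i * ghat A i j * zhat c (contraOf δ) j := by
  rw [← contraOf_bondVec]
  set z := bondVec δ c
  have hz : A z = ∑ i, contraOf z i • A (gen i) := by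
    conv_lhs => rw [expand_contra z]
    simp [map_sum, map_smul]
  rw [← real_inner_self_eq_norm_sq, hz, sum_inner]
  refine Finset.sum_congr rfl fun i _ => ?_
  rw [inner_sum]
  refine Finset.sum_congr rfl fun j _ => ?_
  rw [real_inner_smul_left, real_inner_smul_right, ghat]
  ring

/-- `⟪v, x⟫ = Σᵢ v̂ᵢ x̃ᵢ` (contravariant coordinates of `v` against covariant coordinates of `x`). [folklore] -/
theorem inner_eq_sum_contra_cov (v x : E3) : inner ℝ v x = ∑ i, contraOf v i * covOf x i := by
  conv_lhs => rw [expand_contra v]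
  rw [sum_inner]
  refine Finset.sum_congr rfl fun i _ => ?_
  rw [real_inner_smul_left, covOf]

/-- the entries of `M₀⁻¹`. [folklore] -/
theorem M0inv_val :
    (M0inv 0 0 = 4 / 3 ∧ M0inv 0 1 = -2 / 3 ∧ M0inv 0 2 = 0) ∧ (M0inv 1 0 = -2 / 3 ∧ M0inv 1 1 = 4 / 3 ∧ M0inv 1 2 = 0) ∧
      (M0inv 2 0 = 0 ∧ M0inv 2 1 = 0 ∧ M0inv 2 2 = 3 / 8) := by
  refine ⟨⟨rfl, ?_, rfl⟩, ⟨?_, rfl, rfl⟩, ⟨rfl, rfl, rfl⟩⟩ <;> norm_num [M0inv]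

/-- `⟪dgenᵢ, dgenⱼ⟫ = (M₀⁻¹)ᵢⱼ`. [folklore] -/
theorem inner_dgen (i j : Fin 3) : inner ℝ (dgen i) (dgen j) = (M0inv i j : ℝ) := by
  obtain ⟨⟨a0, a1, a2⟩, ⟨b0, b1, b2⟩, ⟨c0, c1, c2⟩⟩ := dgen_apply
  obtain ⟨⟨m00, m01, m02⟩, ⟨m10, m11, m12⟩, ⟨m20, m21, m22⟩⟩ := M0inv_val
  have h3 : (√3 : ℝ) ^ 2 = 3 := Real.sq_sqrt (by norm_num)
  have h23 : (√(2 / 3) : ℝ) ^ 2 = 2 / 3 := Real.sq_sqrt (by norm_num)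
  rw [inner_fin3]
  fin_cases i <;> fin_cases j <;>
    simp only [Fin.zero_eta, Fin.mk_one, Fin.reduceFinMk, a0, a1, a2, b0, b1, b2, c0, c1, c2,
      m00, m01, m02, m10, m11, m12, m20, m21, m22] <;> push_cast
  · linear_combination (1 / 9 : ℝ) * h3
  · linear_combination (-(2 / 9) : ℝ) * h3
  · ring
  · linear_combination (-(2 / 9) : ℝ) * h3
  · linear_combination (4 / 9 : ℝ) * h3
  · ring
  · ring
  · ring
  · linear_combination (9 / 16 : ℝ) * h23

/-- Anchor of this support file (registered stub of the line skeleton): the contravariant expansion. -/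
theorem stub_certFrame : ∀ x : EuclideanSpace ℝ (Fin 3), x = ∑ i, contraOf x i • gen i := expand_contra

end Summit.AtomisticToContinuum.Crystallization.Theorems.PhononStabilityCWC.Cert

end
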